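import Literature.Analysis.FunctionSpaces.SobolevHolderDomain
import HarnessLib

/-!
# Sobolev norms of smooth maps: post-composition with a linear map, the derivative one level
down, membership of maps smooth up to the boundary; Hölder bounds on closures

Analysis/FunctionSpaces support file (all results proved, no named facts, no definitions) for the
tree's Sobolev classes and sum-form norms on open sets (`MemSobolevDomain`, `eSobolevDomainNorm`,
`SobolevDomain.lean`; R. A. Adams, *Sobolev Spaces* (1975), ¶3.1, L. C. Evans, *PDE*, §5.2). For a
map `φ` which is `C^∞` on the open set `Ω`, so that at every order the infimum in the norm is
attained at the classical derivative (`MeyersSerrin.eSobolevDomainNorm_succ_eq`,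
`MeyersSerrin.hasWeakFDerivOn_of_contDiffOn`):

* `eSobolevDomainNorm_clm_comp_le` — **post-composition with a continuous linear map**
  `Φ : F →L G` is bounded on every `W^{k,p}(Ω)`: `‖Φ ∘ φ‖_{W^{k,p}(Ω)} ≤ ‖Φ‖ ‖φ‖_{W^{k,p}(Ω)}`
  (chain rule `D(Φ ∘ φ) = Φ ∘ Dφ` and induction on `k`; Adams ¶3.1: `W^{m,p}` is a normed space on
  which bounded linear changes of the dependent variable act boundedly — folklore);
* `exists_eSobolevDomainNorm_fderiv_le` — **the derivative loses one order**:
  `‖Dφ‖_{W^{k,p}(Ω; E' →L F)} ≤ C ‖φ‖_{W^{k+1,p}(Ω)}`, `C` depending only on `E'`, `F` (decompose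
  `Dφ(x) = Σᵢ eᵢ* ⊗ Dφ(x)eᵢ` along the basis `Module.finBasis` of the tree norm; each summand is a
  fixed linear map applied to the partial derivative `∂ᵢφ`, whose `W^{k,p}` norms are summands of
  `‖φ‖_{W^{k+1,p}}`);
* `memSobolevDomain_of_contDiffOn` — **maps smooth up to the boundary are in every `W^{k,p}(Ω)`**
  for `Ω` with compact closure inside the set of smoothness (the elementary inclusion
  `C^k(Ω̄) ⊂ W^{k,p}(Ω)` for bounded `Ω`, Adams ¶3.1; companion of the finiteness statement
  `Literature.Analysis.FluidPDE.eSobolevDomainNorm_lt_top_of_contDiffOn`);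
* `holderOnWith_closure_of_continuousOn` — a Hölder bound on `s` for a map continuous on
  `closure s` holds on `closure s` (the Hölder analogue of Mathlib's `LipschitzOnWith.closure`,
  by `le_on_closure` twice).

Written for the Sobolev step of the logarithmic `W^{1,∞}` estimate in the periodic cylinder
(`FluidPDE/PeriodicCylinderSobolevHolder`): `‖curl v‖_{W^{2,2}(cell)} ≲ ‖v‖_{W^{3,2}(cell)}` and the
passage from the open period cell to its closure.

## Mathlib / tree search

Tree: `MeyersSerrin.eSobolevDomainNorm_succ_eq`, `MeyersSerrin.hasWeakFDerivOn_of_contDiffOn`,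
`MeyersSerrin.contDiffOn_fderiv_apply` (`MeyersSerrinProofs`), `SobolevApprox.eSobolevDomainNorm_sum_le`,
`SobolevApprox.eSobolevDomainNorm_congr`, `SobolevApprox.memSobolevDomain_congr`
(`SobolevTraceDensityHigherProofs`); no post-composition or derivative-level bound
(`lean search 'eSobolevDomainNorm_(comp|clm|fderiv)'`: none), no Hölder-on-closure lemma in
Mathlib (`LipschitzOnWith.closure` only). From Mathlib: `ContinuousLinearMap.smulRightL`,
`Module.Basis.sum_repr`, `eLpNorm_le_nnreal_smul_eLpNorm_of_ae_le_mul`, `le_on_closure`,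
`contDiffOn_infty_iff_fderivWithin`, `fderivWithin_of_mem_nhds`, `MemLp.of_bound`.

## References

* R. A. Adams, *Sobolev Spaces*, Academic Press (1975), ¶3.1 (the spaces `W^{m,p}(Ω)`). [Adams1975]
* L. C. Evans, *Partial Differential Equations*, 2nd ed., AMS (2010), §5.2.1–§5.2.3. [Evans2010]
-/

noncomputable section

open MeasureTheory Metric Set Filter Topology Module TopologicalSpace
open scoped ENNReal NNReal ContDiff

namespace Literature.Analysis.FunctionSpaces

/-! ### Post-composition with a continuous linear map; the derivative one level down -/

section SmoothCalculus

variable {E' : Type*} [NormedAddCommGroup E'] [NormedSpace ℝ E'] [FiniteDimensional ℝ E']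
  [MeasurableSpace E'] [BorelSpace E'] {μ : Measure E'} [μ.IsAddHaarMeasure]
variable {F : Type*} [NormedAddCommGroup F] [NormedSpace ℝ F] [CompleteSpace F]
variable {G : Type*} [NormedAddCommGroup G] [NormedSpace ℝ G] [CompleteSpace G]
variable {Ω : Opens E'} {p : ℝ≥0∞}

/-- **Post-composition with a continuous linear map is bounded on `W^{k,p}(Ω)`** (smooth case):
for `φ` of class `C^∞` on the open set `Ω` and `Φ : F →L G`,
`‖Φ ∘ φ‖_{W^{k,p}(Ω)} ≤ ‖Φ‖ ‖φ‖_{W^{k,p}(Ω)}` in the tree's sum-form norm. Induction on `k`: the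
infima are attained at the classical derivatives (`MeyersSerrin.eSobolevDomainNorm_succ_eq`), on
`Ω` the chain rule gives `∂ᵢ(Φ ∘ φ) = Φ ∘ ∂ᵢφ`, and `‖Φ u‖ ≤ ‖Φ‖ ‖u‖` pointwise bounds every
`L^p` norm (Adams, *Sobolev Spaces* (1975), ¶3.1). [folklore] -/
theorem eSobolevDomainNorm_clm_comp_le (Φ : F →L[ℝ] G) :
    ∀ (k : ℕ) {φ : E' → F}, ContDiffOn ℝ ∞ φ Ω →
      eSobolevDomainNorm k p Ω μ (fun x => Φ (φ x)) ≤ ‖Φ‖₊ * eSobolevDomainNorm k p Ω μ φ := by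
  intro k
  induction k with
  | zero =>
    intro φ _
    rw [eSobolevDomainNorm_zero, eSobolevDomainNorm_zero]
    exact le_of_le_of_eq (eLpNorm_le_nnreal_smul_eLpNorm_of_ae_le_mul
      (Eventually.of_forall fun x => Φ.le_opNNNorm (φ x)) p) rfl
  | succ k ih =>
    intro φ hφ
    have hΦφ : ContDiffOn ℝ ∞ (fun x => Φ (φ x)) Ω := Φ.contDiff.comp_contDiffOn hφ
    rw [MeyersSerrin.eSobolevDomainNorm_succ_eq
        (MeyersSerrin.hasWeakFDerivOn_of_contDiffOn (μ := μ) hΦφ),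
      MeyersSerrin.eSobolevDomainNorm_succ_eq (MeyersSerrin.hasWeakFDerivOn_of_contDiffOn (μ := μ) hφ),
      mul_add, Finset.mul_sum]
    refine add_le_add ?_ (Finset.sum_le_sum fun i _ => ?_)
    · exact le_of_le_of_eq (eLpNorm_le_nnreal_smul_eLpNorm_of_ae_le_mul
        (Eventually.of_forall fun x => Φ.le_opNNNorm (φ x)) p) rfl
    · -- on `Ω`, `D(Φ ∘ φ)(x) v = Φ (Dφ(x) v)`
      have heq : EqOn (fun x => fderiv ℝ (fun x => Φ (φ x)) x (Module.finBasis ℝ E' i))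
          (fun x => Φ (fderiv ℝ φ x (Module.finBasis ℝ E' i))) Ω := by
        intro x hx
        have hd : DifferentiableAt ℝ φ x :=
          (hφ.differentiableOn (by simp) x hx).differentiableAt (Ω.isOpen.mem_nhds hx)
        have h2 : fderiv ℝ (fun y => Φ (φ y)) x = Φ.comp (fderiv ℝ φ x) :=
          (Φ.hasFDerivAt.comp x hd.hasFDerivAt).fderiv
        show fderiv ℝ (fun y => Φ (φ y)) x _ = Φ (fderiv ℝ φ x _)
        rw [h2]
        rfl
      rw [SobolevApprox.eSobolevDomainNorm_congr heq]
      exact ih (MeyersSerrin.contDiffOn_fderiv_apply hφ _)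

/-- **The derivative loses one Sobolev order** (smooth case): there is `C` (depending only on
`E'`, `F`) such that for every `φ` of class `C^∞` on the open set `Ω`, every `k` and the derivative
`Dφ : Ω → (E' →L F)` as a map, `‖Dφ‖_{W^{k,p}(Ω)} ≤ C ‖φ‖_{W^{k+1,p}(Ω)}` (`1 ≤ p`). Proof: along the
basis `(eᵢ)` of the tree norm with coordinate functionals `eᵢ*`,
`Dφ(x) = Σᵢ eᵢ* ⊗ Dφ(x)eᵢ` (`Module.Basis.sum_repr`), each summand is the fixed linear map
`u ↦ eᵢ* ⊗ u` (`ContinuousLinearMap.smulRightL`) applied to the partial derivative `∂ᵢφ`, and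
`Σᵢ ‖∂ᵢφ‖_{W^{k,p}}` is a summand of `‖φ‖_{W^{k+1,p}}` (`MeyersSerrin.eSobolevDomainNorm_succ_eq`);
`C = Σᵢ ‖u ↦ eᵢ* ⊗ u‖` (Adams, *Sobolev Spaces* (1975), ¶3.1: `D^α` maps `W^{m,p}` to
`W^{m-|α|,p}` boundedly). [folklore] -/
theorem exists_eSobolevDomainNorm_fderiv_le (hp : 1 ≤ p) :
    ∃ C : ℝ≥0, ∀ (k : ℕ) {φ : E' → F}, ContDiffOn ℝ ∞ φ Ω →
      eSobolevDomainNorm k p Ω μ (fderiv ℝ φ) ≤ C * eSobolevDomainNorm (k + 1) p Ω μ φ := by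
  set b := Module.finBasis ℝ E' with hb
  -- `J i u = eᵢ* ⊗ u`
  set J : Fin (finrank ℝ E') → F →L[ℝ] (E' →L[ℝ] F) := fun i =>
    ContinuousLinearMap.smulRightL ℝ E' F (LinearMap.toContinuousLinearMap (b.coord i)) with hJ
  -- every linear map decomposes along the basis
  have key : ∀ T : E' →L[ℝ] F, T = ∑ i, J i (T (b i)) := by
    intro T
    ext w
    rw [_root_.sum_apply]
    have hJw : ∀ i, J i (T (b i)) w = b.repr w i • T (b i) := fun i => rfl
    simp_rw [hJw]
    conv_lhs => rw [← b.sum_repr w]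
    rw [map_sum]
    simp_rw [map_smul]
  refine ⟨∑ i, ‖J i‖₊, fun k φ hφ => ?_⟩
  have hdec : fderiv ℝ φ = ∑ i, fun x => J i (fderiv ℝ φ x (b i)) := by
    funext x
    rw [Finset.sum_apply]
    exact key (fderiv ℝ φ x)
  have hmeas : ∀ i ∈ Finset.univ,
      AEStronglyMeasurable (fun x => J i (fderiv ℝ φ x (b i))) (μ.restrict Ω) := fun i _ =>
    ((J i).continuous.comp_continuousOn
      (MeyersSerrin.contDiffOn_fderiv_apply hφ (b i)).continuousOn).aestronglyMeasurable
        Ω.isOpen.measurableSet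
  have hle' : ∀ i, ‖J i‖₊ ≤ ∑ j, ‖J j‖₊ := fun i =>
    Finset.single_le_sum (f := fun j => ‖J j‖₊) (fun j _ => by positivity) (Finset.mem_univ i)
  have hle : ∀ i, (‖J i‖₊ : ℝ≥0∞) ≤ ((∑ j, ‖J j‖₊ : ℝ≥0) : ℝ≥0∞) := fun i =>
    ENNReal.coe_le_coe.2 (hle' i)
  calc eSobolevDomainNorm k p Ω μ (fderiv ℝ φ)
      = eSobolevDomainNorm k p Ω μ (∑ i, fun x => J i (fderiv ℝ φ x (b i))) :=
        congrArg (eSobolevDomainNorm k p Ω μ) hdec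
    _ ≤ ∑ i, eSobolevDomainNorm k p Ω μ (fun x => J i (fderiv ℝ φ x (b i))) :=
        SobolevApprox.eSobolevDomainNorm_sum_le _ hmeas hp
    _ ≤ ∑ i, (‖J i‖₊ : ℝ≥0∞) * eSobolevDomainNorm k p Ω μ (fun x => fderiv ℝ φ x (b i)) :=
        Finset.sum_le_sum fun i _ =>
          eSobolevDomainNorm_clm_comp_le (J i) k (MeyersSerrin.contDiffOn_fderiv_apply hφ (b i))
    _ ≤ ∑ i, ((∑ j, ‖J j‖₊ : ℝ≥0) : ℝ≥0∞) *
          eSobolevDomainNorm k p Ω μ (fun x => fderiv ℝ φ x (b i)) :=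
        Finset.sum_le_sum fun i _ => mul_le_mul' (hle i) le_rfl
    _ = ((∑ j, ‖J j‖₊ : ℝ≥0) : ℝ≥0∞) *
          ∑ i, eSobolevDomainNorm k p Ω μ (fun x => fderiv ℝ φ x (b i)) := by
        rw [Finset.mul_sum]
    _ ≤ ((∑ j, ‖J j‖₊ : ℝ≥0) : ℝ≥0∞) * eSobolevDomainNorm (k + 1) p Ω μ φ := by
        rw [MeyersSerrin.eSobolevDomainNorm_succ_eq
          (MeyersSerrin.hasWeakFDerivOn_of_contDiffOn (μ := μ) hφ)]
        exact mul_le_mul' le_rfl le_add_self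

end SmoothCalculus

/-! ### Maps smooth up to the boundary belong to every `W^{k,p}(Ω)` -/

section UpToBoundary

variable {E' : Type*} [NormedAddCommGroup E'] [NormedSpace ℝ E'] [FiniteDimensional ℝ E']
  [MeasurableSpace E'] [BorelSpace E'] {μ : Measure E'} [μ.IsAddHaarMeasure]
variable {F : Type*} [NormedAddCommGroup F] [NormedSpace ℝ F]

omit [NormedSpace ℝ F] in
/-- A function continuous on a compact set `K` is in every `L^p(Ω)`, `Ω ⊆ K` open (a bounded
function on a set of finite Haar measure). [folklore] -/
theorem memLp_restrict_of_continuousOn_isCompact {K : Set E'} (hK : IsCompact K)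
    {Ω : Opens E'} (hΩK : (Ω : Set E') ⊆ K) {f : E' → F} (hf : ContinuousOn f K) (p : ℝ≥0∞) :
    MemLp f p (μ.restrict Ω) := by
  obtain ⟨R, hR⟩ := hK.exists_bound_of_continuousOn hf
  have hμ : μ Ω < ⊤ := (measure_mono hΩK).trans_lt hK.measure_lt_top
  haveI : IsFiniteMeasure (μ.restrict Ω) := isFiniteMeasure_restrict.2 hμ.ne
  have hmeas : AEStronglyMeasurable f (μ.restrict Ω) :=
    (hf.mono hΩK).aestronglyMeasurable Ω.isOpen.measurableSet
  exact MemLp.of_bound hmeas R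
    (ae_restrict_of_forall_mem Ω.isOpen.measurableSet fun x hx => hR x (hΩK hx))

/-- **Maps smooth up to the boundary are in `W^{k,p}(Ω)` for all `k`, `p`.** Let `C` be a set of
unique differentiability (e.g. a closed convex set with nonempty interior) and `Ω` an open set with
compact closure contained in `C`. If `f` is `C^∞` on `C`, then `f ∈ W^{k,p}(Ω)` (the tree's
`MemSobolevDomain`, weak derivatives). Induction on `k`: `f` is bounded on the compact `closure Ω`,
hence in `L^p(Ω)`; its classical derivative is a weak derivative on `Ω`
(`MeyersSerrin.hasWeakFDerivOn_of_contDiffOn`), and each component `x ↦ Df(x) w` agrees on `Ω`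
with `x ↦ D_C f(x) w` (`fderivWithin`), again `C^∞` on `C` (the elementary inclusion
`C^k(Ω̄) ⊂ W^{k,p}(Ω)` for bounded `Ω`, Adams, *Sobolev Spaces* (1975), ¶3.1; companion of
`Literature.Analysis.FluidPDE.eSobolevDomainNorm_lt_top_of_contDiffOn`). [folklore] -/
theorem memSobolevDomain_of_contDiffOn {C : Set E'} (hC : UniqueDiffOn ℝ C)
    {Ω : Opens E'} (hΩ : IsCompact (closure (Ω : Set E'))) (hΩC : closure (Ω : Set E') ⊆ C)
    (p : ℝ≥0∞) (k : ℕ) {f : E' → F} (hf : ContDiffOn ℝ ∞ f C) :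
    MemSobolevDomain k p Ω μ f := by
  induction k generalizing f with
  | zero =>
    rw [memSobolevDomain_zero_iff]
    exact memLp_restrict_of_continuousOn_isCompact hΩ subset_closure (hf.continuousOn.mono hΩC) p
  | succ k ih =>
    have hΩC' : (Ω : Set E') ⊆ C := subset_closure.trans hΩC
    have hfΩ : ContDiffOn ℝ ∞ f (Ω : Set E') := hf.mono hΩC'
    refine ⟨memLp_restrict_of_continuousOn_isCompact hΩ subset_closure (hf.continuousOn.mono hΩC) p,
      fderiv ℝ f, MeyersSerrin.hasWeakFDerivOn_of_contDiffOn hfΩ, fun w => ?_⟩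
    have hD : ContDiffOn ℝ ∞ (fun x => fderivWithin ℝ f C x) C :=
      ((contDiffOn_infty_iff_fderivWithin hC).1 hf).2
    have hDw : ContDiffOn ℝ ∞ (fun x => fderivWithin ℝ f C x w) C := hD.clm_apply contDiffOn_const
    have heq : EqOn (fun x => fderiv ℝ f x w) (fun x => fderivWithin ℝ f C x w) Ω := fun x hx => by
      show fderiv ℝ f x w = fderivWithin ℝ f C x w
      rw [fderivWithin_of_mem_nhds (mem_of_superset (Ω.isOpen.mem_nhds hx) hΩC')]
    exact SobolevApprox.memSobolevDomain_congr (ih hDw) heq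

variable [CompleteSpace F]

/-- **Sobolev norms of maps smooth up to the boundary, classical form at one level**: under the
hypotheses of `memSobolevDomain_of_contDiffOn`,
`‖f‖_{W^{k+1,p}(Ω)} = ‖f‖_{L^p(Ω)} + Σᵢ ‖x ↦ D_C f(x) eᵢ‖_{W^{k,p}(Ω)}` with the *within*-derivative
`D_C f = fderivWithin ℝ f C`, itself `C^∞` on `C` (so that the identity can be iterated): the
infimum is attained at the classical derivative (`MeyersSerrin.eSobolevDomainNorm_succ_eq`), which
agrees with `D_C f` on the open `Ω`. [folklore] -/
theorem eSobolevDomainNorm_succ_eq_fderivWithin {C : Set E'} {Ω : Opens E'}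
    (hΩC : (Ω : Set E') ⊆ C) (p : ℝ≥0∞) (k : ℕ) {f : E' → F} (hf : ContDiffOn ℝ ∞ f C) :
    eSobolevDomainNorm (k + 1) p Ω μ f = eLpNorm f p (μ.restrict Ω) +
      ∑ i, eSobolevDomainNorm k p Ω μ (fun x => fderivWithin ℝ f C x (Module.finBasis ℝ E' i)) := by
  rw [MeyersSerrin.eSobolevDomainNorm_succ_eq (p := p) (k := k)
    (MeyersSerrin.hasWeakFDerivOn_of_contDiffOn (μ := μ) (hf.mono hΩC))]
  congr 1
  refine Finset.sum_congr rfl fun i _ => SobolevApprox.eSobolevDomainNorm_congr fun x hx => ?_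
  show fderiv ℝ f x _ = fderivWithin ℝ f C x _
  rw [fderivWithin_of_mem_nhds (mem_of_superset (Ω.isOpen.mem_nhds hx) hΩC)]

end UpToBoundary

/-! ### Hölder bounds pass to the closure -/

section HolderClosure

variable {X Y : Type*} [PseudoEMetricSpace X] [PseudoEMetricSpace Y]

/-- **A Hölder bound on `s` holds on `closure s`** for a map continuous on `closure s` (the Hölder
analogue of Mathlib's `LipschitzOnWith.closure`): both sides of
`edist (f x) (f y) ≤ C edist x y ^ r` are continuous in `x` and in `y` on `closure s`, so the
inequality passes to the closure one variable at a time (`le_on_closure`). [folklore] -/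
theorem holderOnWith_closure_of_continuousOn {C r : ℝ≥0} {f : X → Y} {s : Set X}
    (hcont : ContinuousOn f (closure s)) (hf : HolderOnWith C r f s) :
    HolderOnWith C r f (closure s) := by
  have hmul : Continuous fun a : ℝ≥0∞ => (C : ℝ≥0∞) * a :=
    ENNReal.continuous_const_mul (ENNReal.coe_ne_top (r := C))
  have hpow : Continuous fun a : ℝ≥0∞ => a ^ (r : ℝ) := ENNReal.continuous_rpow_const
  intro x hx y hy
  have inner : ∀ y' ∈ s, ∀ x' ∈ closure s,
      edist (f x') (f y') ≤ (C : ℝ≥0∞) * edist x' y' ^ (r : ℝ) := by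
    intro y' hy' x' hx'
    refine le_on_closure (f := fun z => edist (f z) (f y'))
      (g := fun z => (C : ℝ≥0∞) * edist z y' ^ (r : ℝ)) (fun z hz => hf z hz y' hy') ?_ ?_ hx'
    · exact (continuous_id.edist continuous_const).comp_continuousOn hcont |>.congr
        (fun z _ => rfl)
    · exact (hmul.comp (hpow.comp (continuous_id.edist continuous_const))).continuousOn
  refine le_on_closure (f := fun z => edist (f x) (f z))
    (g := fun z => (C : ℝ≥0∞) * edist x z ^ (r : ℝ)) (fun z hz => inner z hz x hx) ?_ ?_ hy
  · exact (continuous_const.edist continuous_id).comp_continuousOn hcont |>.congr (fun z _ => rfl)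
  · exact (hmul.comp (hpow.comp (continuous_const.edist continuous_id))).continuousOn

end HolderClosure

end Literature.Analysis.FunctionSpaces
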